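import Summits.CriticalPhenomena.PercolationContinuityZ3.Theorems.Transplant.PlanarSkeletonFrmFromDefs
import Summits.CriticalPhenomena.PercolationContinuityZ3.Theorems.Transplant.SkelFrmFromBChoiceDefsT
import Summits.CriticalPhenomena.PercolationContinuityZ3.Theorems.Transplant.SkelFrmBChoiceDefsT
import Summits.CriticalPhenomena.PercolationContinuityZ3.Theorems.Transplant.PlanarCells2VDefs
import HarnessLib
import Summits.CriticalPhenomena.PercolationContinuityZ3.Theorems.Transplant.SkelFrmBChoiceCellsV
/-!
# U-WAVE PORT (RULING D-U, lead g21 2026-08-26; WAVE-U-MANIFEST v3.0 row «SkelFrmBChoiceCellsV» ↦ «SkelFrmFromBChoiceCellsV») of the tree module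
# `Transplant/SkelFrmBChoiceCellsV` onto the carrier `PlanarSkeletonFrmFrom` (frames only, cylinders connected from width `ℓ₀` on)

ORIGINAL TITLE: N2 (frames-only node `SamePDropOfSkeletonFrm₁`, OPEN) — (ζ″) under (R-44)/(R-45): THE CELL STRUCTURE OF RECORD OF THE SECOND CELL PORT,

builds on p205010 (kernel theorem, internal audit signed; external expert review pending) — nothing in this file uses p205010; NOTHING is claimed about the
OPEN node U `SamePDropOfSkeletonFrmFrom₁` (nor U_s / the end state).  Lane `prim-bschramm`, seat `prim-hp-8 gen 53 (U-wave port pen; tool of record = p3-g26 port_u.py)`; helper file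
(`--supports stmt-CriticalPhenomena-4575 --as helper`).  PORT RULES r1–r4 of RULING D-U: declaration order and proof texts are those of the original,
byte-identical except (i) the carrier token `PlanarSkeletonFrm ↦ PlanarSkeletonFrmFrom` (binders, `namespace`/`end` lines, qualified names of twinned
declarations), (ii) carrier-FREE declarations of the original (φ-level `Skelφ…` blocks and namespace-only arithmetic residents) are NOT re-declared —
this file imports the original and `export`s the twin-free residents (POLICY T / treatment (m1)); residents whose statement mentions a twinned
constant are copied, (iii) every carrier-binding declaration keeps its explicit binder `(Φ : PlanarSkeletonFrmFrom G)` in its own signature (r2).  Docstrings and citations are the original's.  Manifest row idx 54 (level 10; flags verbatim|DEF-ROW); filed by the hp-8 lineage under RULING M-11 (family P-hp8).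
-/

open scoped Classical

noncomputable section

namespace Summit.CriticalPhenomena.PercolationContinuityZ3.Theorems.Transplant

namespace PlanarSkeletonFrmFrom

namespace NegB

open Literature.Probability.Percolation Literature.Probability.LatticeModels SimpleGraph KNCells
open Literature.Probability.Percolation.KozmaNitzan.Cells (oth oth_oth)
open SkelConc (Consts)
open Skelφ.StepI (DataNS)
open Neg

section Values

variable (κ : Consts) {V : Type} [DecidableEq V] [Countable V] {G : SimpleGraph V} [G.LocallyFinite] (Φ : PlanarSkeletonFrmFrom G) (t : V)
  (p : unitInterval) (D : DataNS V) (g f : ℕ) (c hf : Fin 2 → ℕ)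

/-- **The PER-AXIS truncated forward room** `hFV hf I := min (hf I) (2·r (oth I))` (the forward room of a step along `I` is felt on the other coordinate,
so it is capped by twice the OTHER half-side, `PCells2V.hF_le`). [this work] -/
def hFV (I : Fin 2) : ℕ := min (hf I) (2 * (fcellsA κ Φ t p D g f).r (oth I))

/-- `hFV I ≤ 2·r (oth I)` and `hFV I ≤ hf I`. [folklore] -/
theorem hFV_le (I : Fin 2) : hFV κ Φ t p D g f hf I ≤ 2 * (fcellsA κ Φ t p D g f).r (oth I) ∧ hFV κ Φ t p D g f hf I ≤ hf I :=
  ⟨min_le_right _ _, min_le_left _ _⟩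

/-- **Under the value row `hf I ≤ 2·r (oth I)` the truncation is the identity**: `hFV I = hf I`. [folklore] -/
theorem hFV_eq (h : ∀ I, hf I ≤ 2 * (fcellsA κ Φ t p D g f).r (oth I)) (I : Fin 2) : hFV κ Φ t p D g f hf I = hf I := min_eq_left (h I)

/-- **THE CELLS OF RECORD OF THE N2 CHAIN UNDER (R-44)/(R-45)** (`PCells2V`): `fcellsT … c` with the backward transverse room `hB I := 2·r (oth I)` (T's room)
and the forward transverse room the truncated slot value `hFV hf`. [cite: KozmaNitzan2024, §4 p. 25 (the renormalised lattice)] -/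
def fcellsV : PCells2V where
  toPCells2T := fcellsT κ Φ t p D g f c
  hB := fun I => 2 * (fcellsA κ Φ t p D g f).r (oth I)
  hF := hFV κ Φ t p D g f hf
  hB_le := fun _ => le_rfl
  hF_le := fun I => (hFV_le κ Φ t p D g f hf I).1

/-- **The underlying T cells are `fcellsT … c` (by `rfl`)** — every T row (per-axis creep cap, `cenS`, the T box family through `toPCells2T`) carries to
the V function with no re-proof. [folklore] -/
@[simp] theorem fcellsV_toPCells2T : (fcellsV κ Φ t p D g f c hf).toPCells2T = fcellsT κ Φ t p D g f c := rfl

/-- The underlying two-unit cells are `fcellsA` (by `rfl`). [folklore] -/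
theorem fcellsV_toPCells2 : (fcellsV κ Φ t p D g f c hf).toPCells2 = fcellsA κ Φ t p D g f := rfl

/-- `r` of the V cells is `fcellsA`'s (by `rfl`). [folklore] -/
theorem fcellsV_r (i : Fin 2) : (fcellsV κ Φ t p D g f c hf).r i = (fcellsA κ Φ t p D g f).r i := rfl

/-- `s` of the V cells is `fcellsA`'s (by `rfl`). [folklore] -/
theorem fcellsV_s (i : Fin 2) : (fcellsV κ Φ t p D g f c hf).s i = (fcellsA κ Φ t p D g f).s i := rfl

/-- `K` of the V cells is `fcellsA`'s (by `rfl`). [folklore] -/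
theorem fcellsV_K : (fcellsV κ Φ t p D g f c hf).K = (fcellsA κ Φ t p D g f).K := rfl

/-- The creep of the V cells is the truncated creep `cT` (by `rfl`). [folklore] -/
theorem fcellsV_c (i : Fin 2) : (fcellsV κ Φ t p D g f c hf).c i = ((cT κ Φ t p D g f c i : ℕ) : ℤ) := rfl

/-- The backward room is T's: `hB I = 2·r (oth I)` (by `rfl`). [folklore] -/
theorem fcellsV_hB (I : Fin 2) : (fcellsV κ Φ t p D g f c hf).hB I = 2 * (fcellsA κ Φ t p D g f).r (oth I) := rfl

/-- The forward room is the truncated slot value (by `rfl`). [folklore] -/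
theorem fcellsV_hF (I : Fin 2) : (fcellsV κ Φ t p D g f c hf).hF I = hFV κ Φ t p D g f hf I := rfl

/-- `hF I ≤ hf I`. [folklore] -/
theorem fcellsV_hF_le_slot (I : Fin 2) : (fcellsV κ Φ t p D g f c hf).hF I ≤ hf I := (hFV_le κ Φ t p D g f hf I).2

/-- **Under the value row `hf I ≤ 2·r (oth I)` the forward room IS the slot value.** [folklore] -/
theorem fcellsV_hF_eq (h : ∀ I, hf I ≤ 2 * (fcellsA κ Φ t p D g f).r (oth I)) (I : Fin 2) : (fcellsV κ Φ t p D g f c hf).hF I = hf I :=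
  hFV_eq κ Φ t p D g f hf h I

/-- The staggered centres of the V cells are `fcellsT`'s (by `rfl`; `cenS` is inherited from `PCells2T`). [folklore] -/
theorem fcellsV_cenS (v : Site 2) : (fcellsV κ Φ t p D g f c hf).cenS v = (fcellsT κ Φ t p D g f c).cenS v := rfl

/-- **T's symmetric rooms are the V cells at the full forward slot**: `(fcellsT … c).toV = fcellsV … c (2·r ∘ oth)`. [folklore] -/
theorem fcellsT_toV_eq : (fcellsT κ Φ t p D g f c).toV = fcellsV κ Φ t p D g f c (fun I => 2 * (fcellsA κ Φ t p D g f).r (oth I)) := by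
  have h : hFV κ Φ t p D g f (fun I => 2 * (fcellsA κ Φ t p D g f).r (oth I)) = fun I => 2 * (fcellsA κ Φ t p D g f).r (oth I) := by
    funext I; exact min_self _
  unfold fcellsV PCells2T.toV
  congr 1
  exact h.symm

end Values

end NegB

end PlanarSkeletonFrmFrom

end Summit.CriticalPhenomena.PercolationContinuityZ3.Theorems.Transplant

end
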